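import Summits.AtomisticToContinuum.BoseEinsteinCondensation.Theorems.InfraredMinimumUncertainty.Negative.MinimalityLoadBearing
import Summits.AtomisticToContinuum.BoseEinsteinCondensation.Theorems.InfraredMinimumUncertainty.Negative.FreeMinimisersConstant
import Summits.AtomisticToContinuum.BoseEinsteinCondensation.Theorems.PuffFloor.Negative.AntiCorrelatedWitness

/-!
# Negative lemma for crux `InfraredMinimumUncertainty` (stmt-AtomisticToContinuum-11784) — VI:
# the fallback stub `StructureFactorCeiling` of line `fisher-gaussian-density-mode` (gen 2) is FALSE

Supports (does not close) stmt-AtomisticToContinuum-11784 (route `BECConjugateDomination`, crux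
`InfraredMinimumUncertainty`).  Refuter (drefute seat) finding on the stub set of the picked line
`Cruxes/InfraredMinimumUncertainty/Lines/fisher-gaussian-density-mode.lean` (gen 2).

The skeleton types, besides the two registered stubs FD / FG, four fallback statements for its
reshape menu `{DMD, FS}` / `{DMD, SMB, SFC}`.  The density-side fallback **SFC**
(`StructureFactorCeiling`, landed with the line vocabulary in `Theorems/BECConjugateDominationDefs.lean`;
the skeleton's registered-style inline form is certified equal to it by
`structureFactorCeiling_iff_inline := Iff.rfl`) reads: for every smooth-class `v` there are `C ≥ 0`,
`ρ₀ > 0` with `S_m ≤ C‖k‖/√(‖k‖² + ρ)` for every positive torus minimiser, every `m ≠ 0`,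
eventually in `N`, for all `0 < ρ < ρ₀` (`k = 2πm/L`, `L = (N/ρ)^{1/3}`).

**It is false, and the witness is the free gas** (`v ≡ 0`, a member of the smooth class,
`inSmoothClass_zero`): its positive minimisers are the constants and have `S_m = 1` at every mode
`m ≠ 0` and every `N` (`structureFactor_eq_one_of_const`, the computation of
`PuffFloor.Negative.structureFactor_eq_one_of_freeMinimiser` over the pair-correlation toolkit), whereas at a
FIXED mode `m = e₀` the ceiling `C‖k‖/√(‖k‖² + ρ) ≤ C·2π/(L√ρ)` tends to `0` as `N → ∞`
(`L³ = N/ρ`).  Physically: the ideal gas has infinite compressibility, `S(k) ≡ 1`, not Feynman's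
`S(k) ≈ |k|/2mc`; the card's Bogoliubov calibration `S = ‖k‖/√(‖k‖² + 16πρa)` degenerates to `1` at
`a = 0`, and the absorption "`√(‖k‖² + Θρ) ≤ max(1,√Θ)√(‖k‖² + ρ)`, `Θ` into `C`" used to type SFC
with the bare density `ρ` is only valid for `Θ > 0` — it silently excludes `a = 0`.

Classification: **stub-false / misstated** — the minimal repair replaces the healing scale `ρ` by
`ρ·a(v)` (or an `∃ Θ ≥ 0` chosen per `v` and SHARED with `SecondMomentBound`, so that
`SMB ∧ SFC ⇒ FS` survives): `S_m ≤ C‖k‖/√(‖k‖² + Θ(v)ρ)`; the free gas then takes `Θ = 0` and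
satisfies the repaired ceiling with `C = 1` (this witness misses it).  The companion fallback
`SecondMomentBound` (`m₂ ≤ C N‖k‖³√(‖k‖² + ρ)`), `FeynmanSaturation`, `DensityMomentDomination` and
the registered FD / FG all HOLD at the free gas (`m₂ = N‖k‖⁴`, `S = 1`, `ν = 0`), so this witness
kills SFC only; reshape option (C) `{DMD, SMB, SFC}` of the line card must not be registered as
typed.

Contents: `structureFactor_eq_one_of_const` (`S_m = 1` for a state constant on `(ℝ³)^N`),
`ceiling_le` (the elementary bound `C k/√(k²+ρ) ≥ 1 ⇒ L√ρ ≤ 2πκC`),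
`structureFactorCeiling_false : ¬ FisherGaussianDensityMode.StructureFactorCeiling` (the named
statement landed with the line vocabulary; the skeleton's registered-style inline form is `Iff.rfl`
to it, `structureFactorCeiling_iff_inline`).  Nothing here asserts a Theses decl.  All `[folklore]`.
-/

noncomputable section

open MeasureTheory Filter Set
open scoped ENNReal NNReal Topology BigOperators

namespace Summit.AtomisticToContinuum.BoseEinsteinCondensation.Theorems.InfraredMinimumUncertainty.Negative

open Literature.MathematicalPhysics.QuantumManyBody.BoseGas
open Summit.AtomisticToContinuum.BoseEinsteinCondensation.Cruxes.InfraredMinimumUncertainty.FisherGaussianDensityMode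
  (InSmoothClass structureFactor waveVec CruxFrame StructureFactorCeiling)
open Summit.AtomisticToContinuum.BoseEinsteinCondensation.Theorems.PuffFloor.Negative
  (pairCorr continuous_pairCorr integrableOn_cellN_real integral_cellN_pairCorr measureReal_cellN)
open Summit.AtomisticToContinuum.BoseEinsteinCondensation.Theorems.CorrectorClosure.Negative
  (e0 e0_ne_zero sideLength_succ_pos)

/-- **A state that is constant on `(ℝ³)^N` has `S_m = 1` at every mode `m ≠ 0`**:
`N⁻¹∫_{cell^N}|∑ⱼ e_m(xⱼ)|²|c|² = N⁻¹|c|²(∫ t_m + N L^{3N}) = 1` (`∫_{cell^N} t_m = 0` for the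
pair-correlation polynomial `t_m = |∑ⱼe_m(xⱼ)|² − N`, and `|c|²L^{3N} = 1` by normalisation) — the
computation of `PuffFloor.Negative.structureFactor_eq_one_of_freeMinimiser`. [folklore] -/
theorem structureFactor_eq_one_of_const {N : ℕ} {L : ℝ} (hL : 0 < L) (hN : 0 < N)
    (Ψ : PeriodicTrialState N L) {c : ℂ} (hc : ∀ X, Ψ.ψ X = c) {m : Fin 3 → ℤ} (hm : m ≠ 0) :
    (N : ℝ)⁻¹ * ∫ X in cellN N L, ‖∑ j : Fin N, cellWave L m (X j)‖ ^ 2 * ‖Ψ.ψ X‖ ^ 2 = 1 := by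
  -- normalisation: `|c|² L^{3N} = 1`
  have hcn : ‖c‖ ^ 2 * (L ^ 3) ^ N = 1 := by
    have h := Ψ.norm_eq
    simp_rw [hc] at h
    rw [setLIntegral_const, volume_cellN, coe_nnnorm_sq_eq_ofReal, ← ENNReal.ofReal_pow hL.le,
      ← ENNReal.ofReal_pow (by positivity), ← ENNReal.ofReal_mul (by positivity),
      ← ENNReal.ofReal_one, ENNReal.ofReal_eq_ofReal_iff (by positivity) zero_le_one] at h
    exact h
  have hN' : (0 : ℝ) < N := by exact_mod_cast hN
  simp_rw [hc]
  have hfun : (fun X : Config N => ‖∑ j : Fin N, cellWave L m (X j)‖ ^ 2 * ‖c‖ ^ 2) =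
      fun X => ‖c‖ ^ 2 * pairCorr L m X + ‖c‖ ^ 2 * N := by
    funext X; rw [pairCorr, planeWaveSum]; ring
  have hi1 : IntegrableOn (fun X : Config N => ‖c‖ ^ 2 * pairCorr L m X) (cellN N L) volume :=
    (integrableOn_cellN_real L (continuous_pairCorr L m)).const_mul _
  have hi2 : IntegrableOn (fun _ : Config N => ‖c‖ ^ 2 * (N : ℝ)) (cellN N L) volume :=
    integrableOn_const (by
      rw [volume_cellN]; exact ENNReal.pow_ne_top (ENNReal.pow_ne_top ENNReal.ofReal_ne_top))
  rw [hfun, integral_add hi1 hi2, integral_const_mul, integral_cellN_pairCorr hL hm, mul_zero,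
    zero_add, setIntegral_const, measureReal_cellN hL, smul_eq_mul]
  calc (N : ℝ)⁻¹ * ((L ^ 3) ^ N * (‖c‖ ^ 2 * N)) = ‖c‖ ^ 2 * (L ^ 3) ^ N * ((N : ℝ)⁻¹ * N) := by
        ring
    _ = 1 := by rw [inv_mul_cancel₀ hN'.ne', mul_one, hcn]

/-- The elementary step: if the ceiling at wave number `k = (2π/L)κ ≥ 0` is at least `1`,
`1 ≤ C k/√(k² + ρ)`, then `L√ρ ≤ 2πκC` (because `√(k² + ρ) ≥ √ρ`). [folklore] -/
theorem ceiling_le {C κ L ρ : ℝ} (hκ : 0 ≤ κ) (hL : 0 < L) (hρ : 0 < ρ)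
    (h : 1 ≤ C * (2 * Real.pi / L * κ) / Real.sqrt ((2 * Real.pi / L * κ) ^ 2 + ρ)) :
    L * Real.sqrt ρ ≤ 2 * Real.pi * κ * C := by
  set k : ℝ := 2 * Real.pi / L * κ with hk
  have hk0 : 0 ≤ k := by positivity
  have hs : 0 < Real.sqrt (k ^ 2 + ρ) := Real.sqrt_pos.mpr (by positivity)
  have h1 : Real.sqrt (k ^ 2 + ρ) ≤ C * k := (one_le_div hs).mp h
  have h2 : Real.sqrt ρ ≤ Real.sqrt (k ^ 2 + ρ) := Real.sqrt_le_sqrt (by nlinarith)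
  have h3 : Real.sqrt ρ ≤ C * k := h2.trans h1
  calc L * Real.sqrt ρ ≤ L * (C * k) := mul_le_mul_of_nonneg_left h3 hL.le
    _ = 2 * Real.pi * κ * C := by rw [hk]; field_simp

/-- **The structure-factor ceiling SFC is false: the free gas violates it.**  For `v ≡ 0` (in the
smooth class) the constant state `waveState n L 0 = (L^{-3/2})^{⊗N}` is a positive real minimiser
(`E = E₀^per(0) = 0`) with `S_{e₀} = 1` at every `N`, while `C‖k_{e₀}‖/√(‖k_{e₀}‖² + ρ) ≤ 2πC/(L√ρ) < 1`
as soon as `N = ρL³ > ρ(2πC/√ρ)³`. [folklore] -/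
theorem structureFactorCeiling_false : ¬ StructureFactorCeiling := by
  intro h
  obtain ⟨h₁, h₂, h₃, h₄⟩ := inSmoothClass_zero
  obtain ⟨C, hC, ρ₀, hρ₀, H⟩ := h 0 h₁ h₂ h₃ h₄
  -- a density in the window
  set ρ : ℝ := ρ₀ / 2 with hρdef
  have hρ : 0 < ρ := by positivity
  have hρρ₀ : ρ < ρ₀ := by rw [hρdef]; linarith
  have Hev := H ρ hρ hρρ₀
  -- the particle number beyond which the free gas violates the ceiling at the mode `e₀`
  set κ : ℝ := ‖latticeVec (1 : ℝ) e0‖ with hκdef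
  have hκ : 0 ≤ κ := norm_nonneg _
  set A : ℝ := 2 * Real.pi * κ * C / Real.sqrt ρ with hAdef
  have hA : 0 ≤ A := by positivity
  set B : ℝ := ρ * A ^ 3 with hBdef
  obtain ⟨n, hn, hnB⟩ := (Hev.and (Filter.eventually_gt_atTop ⌈B⌉₊)).exists
  have hnB' : B < n := Nat.lt_of_ceil_lt hnB
  set L : ℝ := sideLength ρ (n + 1) with hLdef
  have hL : 0 < L := sideLength_succ_pos hρ n
  -- the constant state, a positive real minimiser of the free periodic energy
  have hε : |(0 : ℝ)| < 1 / 2 := by norm_num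
  have hE0 : periodicEnergy 0 (waveState n hL 0) = 0 := by
    refine le_antisymm ?_ bot_le
    have hle := periodicEnergy_waveState_le (n := n) (ε := 0) hL
    simpa using hle
  have hG0 : periodicGroundStateEnergy (0 : ℝ → ℝ≥0∞) (n + 1) L = 0 :=
    periodicGroundStateEnergy_zero_eq_zero (n + 1) hL
  have hE : periodicEnergy 0 (waveState n hL 0) = periodicGroundStateEnergy 0 (n + 1) L := by
    rw [hE0, hG0]
  have hfin : periodicEnergy 0 (waveState n hL 0) ≠ ⊤ := by
    rw [hE0]; exact ENNReal.zero_ne_top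
  have hreal : ∀ X, (waveState n hL 0).ψ X = (‖(waveState n hL 0).ψ X‖ : ℂ) := fun X =>
    waveFun_eq_norm hL hε X
  have hpos : ∀ X, (waveState n hL 0).ψ X ≠ 0 := fun X => waveFun_ne_zero hL hε X
  -- the ceiling at `m = e₀` for this state …
  have key := hn (waveState n hL 0) hE hfin hreal hpos e0 e0_ne_zero
  -- … whose structure factor is `1`
  obtain ⟨c, hc⟩ := exists_eq_const_of_free_minimiser hL (waveState n hL 0) hE
  have hS : structureFactor n L (waveState n hL 0) e0 = 1 := by
    have h1 := structureFactor_eq_one_of_const hL (Nat.succ_pos n) (waveState n hL 0) hc e0_ne_zero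
    push_cast at h1
    exact h1
  rw [hS] at key
  -- the wave number of the mode `e₀`
  have hk : ‖waveVec L e0‖ = 2 * Real.pi / L * κ := by
    rw [waveVec, norm_smul, Real.norm_eq_abs, abs_of_pos (by positivity)]
  rw [hk] at key
  -- `L√ρ ≤ 2πκC`, i.e. `L ≤ A`, i.e. `N/ρ = L³ ≤ A³`, i.e. `n + 1 ≤ B < n + 1`
  have hLA : L * Real.sqrt ρ ≤ 2 * Real.pi * κ * C := ceiling_le hκ hL hρ key
  have hsρ : 0 < Real.sqrt ρ := Real.sqrt_pos.mpr hρ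
  have hLA' : L ≤ A := by
    rw [hAdef, le_div_iff₀ hsρ]
    exact hLA
  have hL3 : L ^ 3 ≤ A ^ 3 := pow_le_pow_left₀ hL.le hLA' 3
  rw [hLdef, sideLength_succ_pow_three hρ n, div_le_iff₀ hρ] at hL3
  have : ((n : ℝ) + 1) ≤ B := by rw [hBdef]; linarith
  linarith

end Summit.AtomisticToContinuum.BoseEinsteinCondensation.Theorems.InfraredMinimumUncertainty.Negative

end
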